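import Summits.QuantumAdvantage.AdviceFreeQNC0.Pinned39B
import Summits.QuantumAdvantage.AdviceFreeQNC0.RegisterPathSum
import Summits.QuantumAdvantage.AdviceFreeQNC0.TwistBoundX3LocalProof
import HarnessLib

/-!
# Tree port (qn-prover-3 g24), PART 3 of planner qa-qnc0-p1 g39's custody file `qa-qnc0-p1/exp39/Pinned39.lean`
# (sha 36223f84e4fcab77), verbatim; part 2 = `Pinned39B.lean`.  See the module docstring of part 1 for the mathematics.
-/

noncomputable section

namespace Summit.QuantumAdvantage.AdviceFreeQNC0

open Finset Literature.Computability.QuantumComplexity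

namespace BondTwist3

variable {r : ℕ}

section ConstOutputs

open Literature.Computability.MetaComplexity Literature.Computability.QuantumComplexity.RingHLF
open TransferWalk ConstBells TwistedTransfer

variable {n : ℕ}

open scoped Classical in
/-- **MAIN BOUND (constant outputs `b`, pins, twist `γ`; `N = n + 1 ≥ 3`)**:
`‖Σ_x Π_i pin_i(x_i) · e₃(γ·x) · [x ∈ OddZeros ∧ Rel x b]‖ ≤ 3√6 · ρ^{#twisted free sites < n} · 2ⁿ / 2^{#pinned sites < n}`. -/
theorem main_boundZ {ρ : ℝ} (hρ0 : 0 ≤ ρ) (hρ : SiteContracts ρ) (hn2 : 2 ≤ n) (γ : Fin (n + 1) → ZMod 3)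
    (b : Fin (n + 1) → Bool) (pn ξ : ℕ → Bool) :
    ‖∑ x : Fin (n + 1) → Bool, (∏ i : Fin (n + 1), pinF pn ξ i.val (x i)) *
        ((ZMod.stdAddChar (∑ i : Fin (n + 1), if x i then γ i else 0) : ℂ) *
          (if (OddZeros x ∧ RingHLF.Rel x (fun k => b k)) then (1 : ℂ) else 0))‖ ≤
      3 * (Real.sqrt 6 * ρ ^ (siteCnt (fun j => gammaN γ j ≠ 0 ∧ ¬ pn j = true) 0 n) * (2 : ℝ) ^ n /
        (2 : ℝ) ^ (siteCnt (fun j => pn j = true) 0 n)) := by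
  classical
  set M : ℝ := Real.sqrt 6 * ρ ^ (siteCnt (fun j => gammaN γ j ≠ 0 ∧ ¬ pn j = true) 0 n) * (2 : ℝ) ^ n /
    (2 : ℝ) ^ (siteCnt (fun j => pn j = true) 0 n) with hM
  set Pu : (Fin n → Bool) → ℂ := fun u => ∏ m ∈ range (n + 1), pinF pn ξ m (xs u m) with hPu
  have hPx : ∀ u : Fin n → Bool, (∏ i : Fin (n + 1), pinF pn ξ i.val (xOfU u i)) = Pu u := by
    intro u
    simp only [hPu]
    rw [← Fin.prod_univ_eq_prod_range (fun m => pinF pn ξ m (xs u m)) (n + 1)]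
    exact prod_congr rfl fun i _ => by rw [xs_fin u i]
  set F : (Fin (n + 1) → Bool) → ℂ := fun x => (∏ i : Fin (n + 1), pinF pn ξ i.val (x i)) *
    ((ZMod.stdAddChar (∑ i : Fin (n + 1), if x i then γ i else 0) : ℂ) *
      (if (OddZeros x ∧ RingHLF.Rel x (fun k => b k)) then (1 : ℂ) else 0)) with hF
  set E : (Fin n → Bool) → ℂ := fun u => (ZMod.stdAddChar (∑ i : Fin (n + 1), if xOfU u i then γ i else 0) : ℂ) with hE
  set G : (Fin n → Bool) → ℂ := fun u => Pu u * (E u * (if ringWinU (n + 2) (yConst b) u = true then (1 : ℂ) else 0))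
    with hG
  have hodd : ∑ x : Fin (n + 1) → Bool, F x =
      ∑ x ∈ (univ.filter fun x : Fin (n + 1) → Bool => (univ.filter fun j : Fin (n + 1) => x j = false).card % 2 = 1),
        G (uVec x) := by
    rw [← Finset.sum_filter_add_sum_filter_not univ
      (fun x : Fin (n + 1) → Bool => (univ.filter fun j : Fin (n + 1) => x j = false).card % 2 = 1) F]
    have hzero : ∑ x ∈ univ.filter (fun x : Fin (n + 1) → Bool =>
        ¬ (univ.filter fun j : Fin (n + 1) => x j = false).card % 2 = 1), F x = 0 := by
      refine Finset.sum_eq_zero fun x hx => ?_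
      rw [mem_filter] at hx
      have : ¬ (OddZeros x ∧ RingHLF.Rel x (fun k => b k)) := fun h => hx.2 h.1
      simp only [hF, this, if_false, mul_zero]
    rw [hzero, add_zero]
    refine Finset.sum_congr rfl fun x hx => ?_
    rw [mem_filter] at hx
    have hxo : OddZeros x := hx.2
    have hrel : RingHLF.Rel x (fun k => b k) ↔ ringWinU (n + 2) (yConst b) (uVec x) = true :=
      rel_iff_ringWinU hn2 x hx.2 (fun _ k => b k)
    have hP : (∏ i : Fin (n + 1), pinF pn ξ i.val (x i)) = Pu (uVec x) := by
      rw [← hPx (uVec x)]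
      exact prod_congr rfl fun i _ => by rw [xOfU_uVec hn2 x hx.2]
    simp only [hF, hG, hE, xOfU_uVec hn2 x hx.2]
    rw [hP]
    by_cases hr : RingHLF.Rel x (fun k => b k)
    · rw [if_pos ⟨hxo, hr⟩, if_pos (hrel.1 hr)]
    · rw [if_neg (fun h => hr h.2), if_neg (fun h => hr (hrel.2 h))]
  rw [hodd, sum_odd_eq_sum_u hn2 G]
  set κ : ZMod 3 := ((n + 2 + 2 * n : ℕ) : ZMod 3) with hκ
  set C : Bool → ZMod 3 → ℂ := fun on τ => ∑ u : Fin n → Bool, Pu u * (E u *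
    ((if st u n = τ then (1 : ℂ) else 0) * ∏ g : Fin (n + 1), sgnF (on && yConst b g u) κ (st u g.val) τ)) with hC
  have hGsplit : ∀ u : Fin n → Bool, G u =
      (Pu u * (E u * ∑ τ : ZMod 3, (if st u n = τ then (1 : ℂ) else 0) *
          ∏ g : Fin (n + 1), sgnF (false && yConst b g u) κ (st u g.val) τ) -
       Pu u * (E u * ∑ τ : ZMod 3, (if st u n = τ then (1 : ℂ) else 0) *
          ∏ g : Fin (n + 1), sgnF (true && yConst b g u) κ (st u g.val) τ)) / 2 := by
    intro u
    have hsign := winSign_eq_sum (n + 2) (yConst b) u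
    have hsg : ∀ (τ : ZMod 3) (g : Fin (n + 1)),
        (if (yConst b g u = true ∧ ((n + 2 + 2 * n : ℕ) : ZMod 3) + st u g.val + τ ≠ 0) then (-1 : ℂ) else 1) =
          sgnF (true && yConst b g u) κ (st u g.val) τ := fun τ g => rfl
    simp only [hsg] at hsign
    rw [sum_resolve_off κ b u, ← hsign]
    simp only [hG]
    split_ifs <;> ring
  have hGsum : ∑ u : Fin n → Bool, G u = ((∑ τ : ZMod 3, C false τ) - ∑ τ : ZMod 3, C true τ) / 2 := by
    simp_rw [hGsplit]
    rw [← Finset.sum_div, Finset.sum_sub_distrib]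
    congr 2
    · simp only [hC]; rw [Finset.sum_comm]
      exact sum_congr rfl fun u _ => by rw [Finset.mul_sum, Finset.mul_sum]
    · simp only [hC]; rw [Finset.sum_comm]
      exact sum_congr rfl fun u _ => by rw [Finset.mul_sum, Finset.mul_sum]
  rw [hGsum, norm_div, Complex.norm_two]
  have hB : ∀ on τ, ‖C on τ‖ ≤ M := fun on τ => core_boundZ hρ0 hρ on γ b κ τ pn ξ
  have h3 : ∀ on, ‖∑ τ : ZMod 3, C on τ‖ ≤ 3 * M := by
    intro on
    calc ‖∑ τ : ZMod 3, C on τ‖ ≤ ∑ τ : ZMod 3, ‖C on τ‖ := norm_sum_le _ _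
      _ ≤ ∑ _τ : ZMod 3, M := sum_le_sum fun τ _ => hB on τ
      _ = 3 * M := by rw [sum_const, card_univ, ZMod.card]; simp
  have htri := norm_sub_le (∑ τ : ZMod 3, C false τ) (∑ τ : ZMod 3, C true τ)
  have hM0 : 0 ≤ M := by rw [hM]; positivity
  have := h3 false; have := h3 true
  linarith

/-! ### The letters' bookkeeping and the theorem -/

/-- Pinned letters as an `ℕ`-indexed Boolean vector. -/
def pnOf (P : Finset (Fin (n + 1))) (m : ℕ) : Bool := if h : m < n + 1 then decide ((⟨m, h⟩ : Fin (n + 1)) ∈ P) else false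

/-- Pinned values as an `ℕ`-indexed Boolean vector. -/
def ξN (ξ : Fin (n + 1) → Bool) (m : ℕ) : Bool := if h : m < n + 1 then ξ ⟨m, h⟩ else false

open scoped Classical in
/-- The pin factors multiply to the pin indicator. -/
theorem pin_prod_eq (P : Finset (Fin (n + 1))) (ξ x : Fin (n + 1) → Bool) :
    (∏ i : Fin (n + 1), pinF (pnOf P) (ξN ξ) i.val (x i)) = if (∀ i ∈ P, x i = ξ i) then (1 : ℂ) else 0 := by
  classical
  have h1 : ∀ i : Fin (n + 1), pinF (pnOf P) (ξN ξ) i.val (x i) =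
      if i ∈ P then (if x i = ξ i then (1 : ℂ) else 0) else 1 := by
    intro i
    unfold pinF pnOf ξN
    simp only [dif_pos i.isLt, Fin.eta, decide_eq_true_eq]
  rw [prod_congr rfl fun i _ => h1 i, Finset.prod_ite_mem, Finset.univ_inter, Finset.prod_boole]
  congr

/-- Counting sites: `siteCnt p 0 L = #{i : Fin L | p i}`. -/
theorem siteCnt_eq_card (p : ℕ → Prop) [DecidablePred p] (L : ℕ) :
    siteCnt p 0 L = (univ.filter fun i : Fin L => p i.val).card := by
  unfold siteCnt
  simp only [zero_add]
  rw [Finset.card_filter, Fin.sum_univ_eq_sum_range (fun m => if p m then 1 else 0) L]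

/-- auxiliary lemma `siteCnt_range_succ` (planner p1 g39, exp39; ported verbatim). -/
theorem siteCnt_range_succ (p : ℕ → Prop) [DecidablePred p] (L : ℕ) :
    siteCnt p 0 (L + 1) = siteCnt p 0 L + (if p L then 1 else 0) := by
  unfold siteCnt
  simp only [zero_add]
  rw [sum_range_succ]

/-- The free twisted sites `< n` are all but at most one of the free twisted letters. -/
theorem card_free_twisted_le (P : Finset (Fin (n + 1))) (γ : Fin (n + 1) → ZMod 3) :
    (univ.filter fun i : Fin (n + 1) => i ∉ P ∧ γ i ≠ 0).card ≤
      siteCnt (fun j => gammaN γ j ≠ 0 ∧ ¬ pnOf P j = true) 0 n + 1 := by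
  classical
  have h1 : (univ.filter fun i : Fin (n + 1) => i ∉ P ∧ γ i ≠ 0).card =
      siteCnt (fun j => gammaN γ j ≠ 0 ∧ ¬ pnOf P j = true) 0 (n + 1) := by
    rw [siteCnt_eq_card]
    congr 1
    ext i
    simp only [mem_filter, mem_univ, true_and]
    unfold gammaN pnOf
    simp only [dif_pos i.isLt, Fin.eta, decide_eq_true_eq]
    tauto
  rw [h1, siteCnt_range_succ]
  split_ifs <;> omega

/-- The pinned sites `< n` are all but at most one of the pinned letters. -/
theorem card_pinned_le (P : Finset (Fin (n + 1))) :
    P.card ≤ siteCnt (fun j => pnOf P j = true) 0 n + 1 := by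
  classical
  have h1 : P.card = siteCnt (fun j => pnOf P j = true) 0 (n + 1) := by
    rw [siteCnt_eq_card]
    congr 1
    ext i
    simp only [mem_filter, mem_univ, true_and]
    unfold pnOf
    simp only [dif_pos i.isLt, Fin.eta, decide_eq_true_eq]
  rw [h1, siteCnt_range_succ]
  split_ifs <;> omega

/-- `SiteContracts` is monotone in the rate. -/
theorem siteContracts_mono {ρ ρ' : ℝ} (h : SiteContracts ρ) (hle : ρ ^ 2 ≤ ρ' ^ 2) : SiteContracts ρ' :=
  fun ζ h3 h1 ω hω ε f => (h ζ h3 h1 ω hω ε f).trans (mul_le_mul_of_nonneg_right hle (rnsq_nonneg f))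

open scoped Classical in
/-- The trivial bound for the pinned twisted win sum: norm `≤ 2^N`. -/
theorem trivial_boundZ (N : ℕ) (P : Finset (Fin N)) (ξ b : Fin N → Bool) (β : Fin N → ZMod 3) :
    ‖∑ x : Fin N → Bool, (if (∀ i ∈ P, x i = ξ i) then (1 : ℂ) else 0) *
        ((ZMod.stdAddChar (∑ i : Fin N, if x i then β i else 0) : ℂ) *
          (if (OddZeros x ∧ RingHLF.Rel x (fun k => b k)) then (1 : ℂ) else 0))‖ ≤ (2 : ℝ) ^ N := by
  classical
  refine (norm_sum_le _ _).trans ?_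
  have hterm : ∀ x : Fin N → Bool, ‖(if (∀ i ∈ P, x i = ξ i) then (1 : ℂ) else 0) *
        ((ZMod.stdAddChar (∑ i : Fin N, if x i then β i else 0) : ℂ) *
          (if (OddZeros x ∧ RingHLF.Rel x (fun k => b k)) then (1 : ℂ) else 0))‖ ≤ 1 := by
    intro x
    rw [norm_mul, norm_mul]
    have h0 : ‖(if (∀ i ∈ P, x i = ξ i) then (1 : ℂ) else 0)‖ ≤ 1 := by split_ifs <;> simp
    have h1 : ‖(ZMod.stdAddChar (∑ i : Fin N, if x i then β i else 0) : ℂ)‖ ≤ 1 := by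
      have h3 := stdAddChar_cube (∑ i : Fin N, if x i then β i else 0)
      have hn : ‖(ZMod.stdAddChar (∑ i : Fin N, if x i then β i else 0) : ℂ)‖ ^ 3 = 1 := by
        rw [← norm_pow, h3, norm_one]
      exact ((pow_eq_one_iff_of_nonneg (norm_nonneg _) (by norm_num)).1 hn).le
    have h2 : ‖(if (OddZeros x ∧ RingHLF.Rel x (fun k => b k)) then (1 : ℂ) else 0)‖ ≤ 1 := by
      split_ifs <;> simp
    exact mul_le_one₀ h0 (by positivity) (mul_le_one₀ h1 (norm_nonneg _) h2)
  refine (sum_le_sum fun x _ => hterm x).trans ?_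
  rw [sum_const, card_univ, Fintype.card_fun, Fintype.card_bool, Fintype.card_fin]
  simp

open scoped Classical in
/-- **`TwistBoundZConstPinned ρ`** — restated verbatim from `exp39/SparseRead39.lean` (which this file cannot import; the
definitions `pinSum`/`pinInd`/`phase`/`ind` there are unfolded here): the twisted win sum of a CONSTANT-OUTPUT strategy `b`
on the subcube pinned to `ξ` on `P` decays like `ρ^{#free twisted letters}`, normalised by the subcube size `2^{N − |P|}`. -/
def TwistBoundZConstPinned (ρ : ℝ) : Prop :=
  ∃ A : ℝ, ∀ (N : ℕ) (P : Finset (Fin N)) (ξ b : Fin N → Bool) (β : Fin N → ZMod 3),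
    ‖∑ x : Fin N → Bool, (if (∀ i ∈ P, x i = ξ i) then (1 : ℂ) else 0) *
        ((ZMod.stdAddChar (∑ i : Fin N, if x i then β i else 0) : ℂ) *
          (if (OddZeros x ∧ RingHLF.Rel x (fun k => b k)) then (1 : ℂ) else 0))‖
      ≤ A * ρ ^ (univ.filter fun i : Fin N => i ∉ P ∧ β i ≠ 0).card * (2 : ℝ) ^ (N - P.card)

/-- **THEOREM (A39-7): `TwistBoundZConstPinned ρ` holds for some `ρ < 1`** — hence (R1)₀ `R1Zero ρ` by
`SparseRead39.r1Zero_of_pinned`. -/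
theorem twistBoundZConstPinned : ∃ ρ : ℝ, 0 ≤ ρ ∧ ρ < 1 ∧ TwistBoundZConstPinned ρ := by
  classical
  obtain ⟨ρ₀, hρ0, hρ1, hS⟩ := siteContracts_exists
  set ρ : ℝ := max ρ₀ (1 / 2) with hρdef
  have hρpos : 0 < ρ := lt_of_lt_of_le (by norm_num) (le_max_right _ _)
  have hρlt : ρ < 1 := max_lt hρ1 (by norm_num)
  have hρle1 : ρ ≤ 1 := hρlt.le
  have hSρ : SiteContracts ρ := siteContracts_mono hS (pow_le_pow_left₀ hρ0 (le_max_left _ _) 2)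
  refine ⟨ρ, hρpos.le, hρlt, 3 * Real.sqrt 6 / ρ + 4 / ρ ^ 2, fun N P ξ b β => ?_⟩
  set w := (univ.filter fun i : Fin N => i ∉ P ∧ β i ≠ 0).card with hw
  have hwN : w ≤ N := (card_filter_le _ _).trans (by simp)
  have hPN : P.card ≤ N := (card_le_univ P).trans (by simp)
  have hA1 : 0 ≤ 3 * Real.sqrt 6 / ρ := by positivity
  have hA2 : 0 ≤ 4 / ρ ^ 2 := by positivity
  have hρw : 0 ≤ ρ ^ w := by positivity
  have h2NP : (1 : ℝ) ≤ (2 : ℝ) ^ (N - P.card) := one_le_pow₀ (by norm_num)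
  rcases Nat.lt_or_ge N 3 with hN | hN
  · -- tiny `N`: the trivial bound
    have htriv := trivial_boundZ N P ξ b β
    have h2N : (2 : ℝ) ^ N ≤ 4 := by
      calc (2 : ℝ) ^ N ≤ 2 ^ 2 := pow_le_pow_right₀ (by norm_num) (by omega)
        _ = 4 := by norm_num
    have hρw2 : ρ ^ 2 ≤ ρ ^ w := pow_le_pow_of_le_one hρpos.le hρle1 (by omega)
    have hkey : (4 : ℝ) ≤ (4 / ρ ^ 2) * ρ ^ w * (2 : ℝ) ^ (N - P.card) := by
      have hρ2 : ρ ^ 2 ≠ 0 := by positivity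
      have h4 : (4 : ℝ) ≤ 4 / ρ ^ 2 * ρ ^ w :=
        calc (4 : ℝ) = 4 / ρ ^ 2 * ρ ^ 2 := by field_simp
          _ ≤ 4 / ρ ^ 2 * ρ ^ w := mul_le_mul_of_nonneg_left hρw2 hA2
      nlinarith
    calc _ ≤ (2 : ℝ) ^ N := htriv
      _ ≤ 4 := h2N
      _ ≤ (4 / ρ ^ 2) * ρ ^ w * (2 : ℝ) ^ (N - P.card) := hkey
      _ ≤ (3 * Real.sqrt 6 / ρ + 4 / ρ ^ 2) * ρ ^ w * (2 : ℝ) ^ (N - P.card) := by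
          gcongr; linarith
  · -- `N = n + 1`, `n ≥ 2`: the main bound
    obtain ⟨n, rfl⟩ : ∃ n, N = n + 1 := ⟨N - 1, by omega⟩
    have hn2 : 2 ≤ n := by omega
    have hmain := main_boundZ hρpos.le hSρ hn2 β b (pnOf P) (ξN ξ)
    simp_rw [pin_prod_eq P ξ] at hmain
    set t := siteCnt (fun j => gammaN β j ≠ 0 ∧ ¬ pnOf P j = true) 0 n with ht
    set p := siteCnt (fun j => pnOf P j = true) 0 n with hp
    have htw : w ≤ t + 1 := by rw [hw, ht]; exact card_free_twisted_le P β
    have hpP : P.card ≤ p + 1 := by rw [hp]; exact card_pinned_le P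
    -- `ρ^t ≤ ρ^w / ρ` and `2^n / 2^p ≤ 2^(N − |P|)`
    have hrate : ρ ^ t ≤ ρ ^ w / ρ := by
      rw [le_div_iff₀ hρpos, ← pow_succ]
      exact pow_le_pow_of_le_one hρpos.le hρle1 htw
    have hcube : (2 : ℝ) ^ n / (2 : ℝ) ^ p ≤ (2 : ℝ) ^ (n + 1 - P.card) := by
      rw [div_le_iff₀ (by positivity), ← pow_add]
      exact pow_le_pow_right₀ (by norm_num) (by omega)
    have hfin : 3 * (Real.sqrt 6 * ρ ^ t * (2 : ℝ) ^ n / (2 : ℝ) ^ p) ≤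
        (3 * Real.sqrt 6 / ρ) * ρ ^ w * (2 : ℝ) ^ (n + 1 - P.card) := by
      have e : 3 * (Real.sqrt 6 * ρ ^ t * (2 : ℝ) ^ n / (2 : ℝ) ^ p) =
          3 * Real.sqrt 6 * ρ ^ t * ((2 : ℝ) ^ n / (2 : ℝ) ^ p) := by ring
      have e2 : (3 * Real.sqrt 6 / ρ) * ρ ^ w * (2 : ℝ) ^ (n + 1 - P.card) =
          3 * Real.sqrt 6 * (ρ ^ w / ρ) * (2 : ℝ) ^ (n + 1 - P.card) := by ring
      rw [e, e2]
      have h6 : 0 ≤ 3 * Real.sqrt 6 := by positivity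
      have hq : 0 ≤ (2 : ℝ) ^ n / (2 : ℝ) ^ p := by positivity
      calc 3 * Real.sqrt 6 * ρ ^ t * ((2 : ℝ) ^ n / (2 : ℝ) ^ p)
          ≤ 3 * Real.sqrt 6 * (ρ ^ w / ρ) * ((2 : ℝ) ^ n / (2 : ℝ) ^ p) := by gcongr
        _ ≤ 3 * Real.sqrt 6 * (ρ ^ w / ρ) * (2 : ℝ) ^ (n + 1 - P.card) := by
            have : 0 ≤ 3 * Real.sqrt 6 * (ρ ^ w / ρ) := by positivity
            exact mul_le_mul_of_nonneg_left hcube this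
    calc _ ≤ 3 * (Real.sqrt 6 * ρ ^ t * (2 : ℝ) ^ n / (2 : ℝ) ^ p) := hmain
      _ ≤ (3 * Real.sqrt 6 / ρ) * ρ ^ w * (2 : ℝ) ^ (n + 1 - P.card) := hfin
      _ ≤ (3 * Real.sqrt 6 / ρ + 4 / ρ ^ 2) * ρ ^ w * (2 : ℝ) ^ (n + 1 - P.card) := by
          gcongr; linarith

end ConstOutputs

end BondTwist3

end Summit.QuantumAdvantage.AdviceFreeQNC0
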